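import Literature.IUT.LogThetaLattice.BiCoresRealifiedRigidity
import Literature.IUT.LogThetaLattice.BiCoresProofsIVV
import Literature.IUT.HodgeArakelov.RealifiedDFunctor
import HarnessLib

/-!
# [IUTchIII] Thm 1.5 (v) / [IUTchII] Cor 4.10 (v) for bi-coric data whose `D^⊩(−)` is read in the `ℝ_{>0}`-torsor
# category of collections of data `(C^⊩, Prime(C^⊩) ⥲ V̲, {ρ_v}_v)` (proof-only)

Proof-only companion (abc-iut cell, D-0067 wave 4, seat abc-iut-w4-d005; plan/GAP-LEDGER.md row **G-w4d009-1**,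
complement (b) of L6-lead §F v1.18d, agreed with abc-iut-w4-d009 g2 01:55:16Z; no definitions, no typer file edited) of
`BiCoresRealifiedRigidity.lean` (abc-iut-w4-d009, p412780: the criteria `thm15vSingleIso_iff_mapIso_aut`,
`realifiedRigidAt_self_iff`, `realifiedTransport_eq_orbit_of_mapIso_aut`), `BiCoresProofsIVV.lean` (abc-iut-w4-d006, p411998:
`LatticeGlue.thm15v_singleIso_lattice` / `thm15v_orbit_compat_horizontal` with the rigidity as hypothesis `hv`),
`RealifiedDataDegreeTorsor.lean` (abc-iut-w4-d009 g2: the CATEGORY `RlfData V` of collections of data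
`(C^⊩, Prime ⥲ V̲, {ρ_v})` with its `ℝ_{>0}`-torsor hom-sets, `Hom.IsFrobPreservingAt`, `eq_id_of_isFrobPreservingAt`) and
`RealifiedDFunctor.lean` (abc-iut-w4-d009 g2: the FUNCTOR `realifiedD` of [IUTchII] Cor 4.5 (ii)
`‡D^⊢ ↦ (D^⊩(‡D^⊢), Prime ⥲ V̲, {‡ρ_{D^⊩,v}})`, `realifiedD_map_endo`, `realifiedD_mapIso_eq_refl`).

S. Mochizuki, *Inter-universal Teichmüller theory II*, kurims manuscript (Dec 2020), Cor 4.10 (v) p. 160 l. 77 – p. 161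
l. 9 (own render `paper:url-5036b4059555/p0160.txt`, `p0161.txt`): "The full poly-isomorphism `†D^⊢_△ ⥲ ‡D^⊢_△` of (iv)
induces [cf. Corollary 4.5, (ii)] an isomorphism of collections of data `(D^⊩(†D^⊢_△), Prime(D^⊩(†D^⊢_△)) ⥲ V̲,
{†ρ_{D^⊩,v}}_{v∈V̲}) ⥲ (D^⊩(‡D^⊢_△), Prime(D^⊩(‡D^⊢_△)) ⥲ V̲, {‡ρ_{D^⊩,v}}_{v∈V̲})` … Moreover, this isomorphism of collections of
data is compatible, relative to the `Θ^{×μ}`- and `Θ^{×μ}_{gau}`-links of (iii), with the `ℝ_{>0}`-orbits of the isomorphisms of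
collections of data `(†C^⊩_△, …) ⥲ (D^⊩(†D^⊢_△), …)` … obtained by applying the functorial algorithm discussed in the final
portion of Corollary 4.6, (ii)"; *III* (May 2020) Thm 1.5 (v) pp. 50–51 (the same clause along the log-theta-lattice).
Claim key `Mochizuki2012` DISPUTED (D-0012).

WHAT IS PROVED (bookkeeping over interfaces; the node `IUTchIII:Thm1.5(v)` / FACT-LIST F-2066 `RealifiedRigidAt`, F-2067
`Thm15vSingleIso` become THEOREMS at every instantiation of the kind below — the GAP row's "prove in-cone at the model").
For a bi-coric datum `B : BiCoricData S` ([IUTchIII] §1 interface, abc-iut-L6-t3) whose abstract output category `B.RFrob`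
of `D^⊢ ↦ (D^⊩(D^⊢), Prime ⥲ V̲, {ρ_v})` is READ in the category of record `RlfData V` by a FAITHFUL functor `U`:

§A (print's mechanism, [AbsTopIII] Prop 5.8 (iii)/(vi) "Frobenius elements are functorial"): if `U ∘ D^⊩(−)` sends every
automorphism of each `^{n,m}D^⊢_△` to a morphism of data that is Frobenius-preserving at ONE place `v` — as every morphism
induced by an isomorphism of `D^⊢`-prime-strips is (`log^{†D^⊢}(p_v) ↦ log^{‡D^⊢}(p_v)`) — then `D^⊩(−)` kills that
automorphism (`realified_mapIso_eq_refl_of_frobPreserving`; although `Aut ≅ ℝ_{>0}` in the ambient category,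
`RlfData.dilate_ne_id`), hence Thm 1.5 (v)'s "AN isomorphism" (`thm15vSingleIso_of_frobPreserving`) and Cor 4.10 (v)'s
rigidity at every pair (`realifiedRigidAt_of_frobPreserving`).
§B (the instantiation shape of G-w4d009-1): if `B.realified` IS [IUTchII] Cor 4.5 (ii)'s functor — `U`-faithfully and up
to a natural isomorphism `η : B.realified ⋙ U ≅ Φ ⋙ realifiedD line c hc` for some `Φ : S.Dv ⥤ 𝒟` (e.g. the identity) —
then `B.realified.mapIso a = Iso.refl _` for EVERY automorphism `a` (`realified_mapIso_eq_refl_of_realifiedD`, the literal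
signature of the GAP row: `LatticeGlue.cor410v_realified_kills_aut_of_realifiedD`), `B.Thm15vSingleIso`, `B.RealifiedRigidAt X Y`
for all `X Y`, the commuting system `biCoricRealifiedIso_trans/_symm/_self`, the `ℝ_{>0}`-orbit compatibility
`realifiedTransport_eq_orbit_of_realifiedD`, and abc-iut-w4-d006's lattice theorems with their hypothesis `hv` DISCHARGED
(`LatticeGlue.thm15v_singleIso_lattice_of_realifiedD`, `thm15v_orbit_compat_horizontal_of_realifiedD`).
NON-VACUITY of the hypotheses (a bi-coric datum over abc-iut-L6-t3's witness frame — where `Aut(^{n,m}D^⊢_△) ∋ −1 ≠ id` —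
whose `RFrob` is a model of the genuine torsor category `RlfData V`, `realified := realifiedD`, `realifiedKummer :=` the
FULL `ℝ_{>0}`-orbit) is the small definition file `BiCoresRealifiedDFunctorWitness.lean` (same seat).

HONEST FRAMING: nothing here asserts a disputed claim or takes a side on [IUTchIII] Cor 3.12; `RealifiedRigidAt` for a
bi-coric datum read in some OTHER way remains the named hypothesis it was; typed ≠ proved upstream. No new Prop fact.
-/

namespace Literature.IUT.LogThetaLattice

open CategoryTheory
open Literature.IUT.HodgeTheaters Literature.IUT.HodgeArakelov Literature.AnabelianGeometry.AbsoluteAnabelian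

universe u w u₁ v₁ u₂

namespace BiCoricData

variable {S : StripFrame.{u}} (B : BiCoricData S) {V : Type u₂}

/-! ### §A. `D^⊩(−)` read in `RlfData V`: Frobenius-preserving images of automorphisms ⇒ rigidity -/

section FrobPreserving

variable (U : B.RFrob ⥤ RlfData.{u₂, w} V) [U.Faithful]

/-- **IUTchII:Cor4.10(v)** (kurims p. 160) with **AbsTopIII:Prop5.8(iii)** (Frobenius elements are functorial): if the
collection of data `D^⊩(X)` is read faithfully in `RlfData V` and `D^⊩(f)`, `f` an endomorphism of the `D^⊢`-prime-strip `X`,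
is Frobenius-preserving at one place, then `D^⊩(f)` is the identity (`RlfData.eq_id_of_isFrobPreservingAt`).
[claim: Mochizuki2012, status: disputed] -/
theorem realified_map_endo_of_frobPreserving {X : S.Dv} (f : X ⟶ X) (v : V)
    (h : (U.map (B.realified.map f)).IsFrobPreservingAt v) : B.realified.map f = 𝟙 _ := by
  apply U.map_injective
  rw [U.map_id]
  exact RlfData.eq_id_of_isFrobPreservingAt _ v h

/-- **IUTchII:Cor4.10(v)** (kurims p. 160) / **IUTchIII:Thm1.5(v)** (p. 50): … hence `D^⊩(−)` KILLS every automorphism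
of `X` whose image is Frobenius-preserving at one place — the ambient category being non-rigid (`RlfData.dilate_ne_id`).
[claim: Mochizuki2012, status: disputed] -/
theorem realified_mapIso_eq_refl_of_frobPreserving {X : S.Dv} (a : X ≅ X) (v : V)
    (h : (U.map (B.realified.map a.hom)).IsFrobPreservingAt v) : B.realified.mapIso a = Iso.refl _ :=
  Iso.ext (B.realified_map_endo_of_frobPreserving U a.hom v h)

/-- **IUTchIII:Thm1.5(v)** (kurims p. 50) "induce [cf. [IUTchII], Corollaries 4.5, (ii); 4.10, (v)] AN isomorphism of
collections of data" — PROVED for every bi-coric datum whose `D^⊩(−)`, read faithfully in `RlfData V`, sends each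
automorphism of each `^{n,m}D^⊢_△` to a morphism Frobenius-preserving at some place (FACT-LIST F-2067 at such `B`).
[claim: Mochizuki2012, status: disputed] -/
theorem thm15vSingleIso_of_frobPreserving (v : S.DHT → V)
    (h : ∀ (H : S.DHT) (a : B.dvDeltaOf H ≅ B.dvDeltaOf H),
      (U.map (B.realified.map a.hom)).IsFrobPreservingAt (v H)) :
    B.Thm15vSingleIso :=
  B.thm15vSingleIso_iff_mapIso_aut.mpr fun H a => B.realified_mapIso_eq_refl_of_frobPreserving U a (v H) (h H a)

/-- **IUTchII:Cor4.10(v)** (kurims p. 160) the consumer-side hypothesis `RealifiedRigidAt X Y` of abc-iut-L6-t3 — PROVED at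
every pair of `D^⊢`-prime-strips for such a bi-coric datum (FACT-LIST F-2066 at such `B`). [claim: Mochizuki2012, status: disputed] -/
theorem realifiedRigidAt_of_frobPreserving (v : S.Dv → V)
    (h : ∀ (X : S.Dv) (a : X ≅ X), (U.map (B.realified.map a.hom)).IsFrobPreservingAt (v X)) (X Y : S.Dv) :
    B.RealifiedRigidAt X Y :=
  B.realifiedRigidAt_of_self
    ((B.realifiedRigidAt_self_iff X).mpr fun a => B.realified_mapIso_eq_refl_of_frobPreserving U a (v X) (h X a)) Y

end FrobPreserving

/-! ### §B. `D^⊩(−)` = [IUTchII] Cor 4.5 (ii)'s functor `realifiedD` (up to a faithful reading): the GAP-row shape -/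

section RealifiedD

variable {𝒟 : Type u₁} [Category.{v₁} 𝒟] (line : 𝒟 → V → RLine.{w}) (c : V → ℝ) (hc : ∀ v, 0 < c v)
  (Φ : S.Dv ⥤ 𝒟) (U : B.RFrob ⥤ RlfData.{u₂, w} V) [U.Faithful]
  (η : B.realified ⋙ U ≅ Φ ⋙ realifiedD line c hc)

include η

/-- **IUTchII:Cor4.10(v)** (kurims p. 160) if `D^⊩(−)` is (faithfully, up to natural isomorphism) the functor of
[IUTchII] Cor 4.5 (ii) — whose morphism part is FORCED: degree `1` and THE Frobenius-preserving line isomorphisms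
(abc-iut-w4-d009 g2 `realifiedD`, `realifiedD_map_endo`) — then `D^⊩(−)` sends every ENDOMORPHISM of a `D^⊢`-prime-strip to
the identity. [claim: Mochizuki2012, status: disputed] -/
theorem realified_map_endo_of_realifiedD {X : S.Dv} (f : X ⟶ X) : B.realified.map f = 𝟙 _ := by
  apply U.map_injective
  have hnat := η.hom.naturality f
  have hD : (Φ ⋙ realifiedD line c hc).map f = 𝟙 _ := realifiedD_map_endo line c hc (Φ.map f)
  rw [hD, Category.comp_id] at hnat
  have h2 : (B.realified ⋙ U).map f = 𝟙 _ :=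
    (Iso.cancel_iso_hom_right ((B.realified ⋙ U).map f) (𝟙 _) (η.app X)).mp
      (by rw [Category.id_comp]; exact hnat)
  rw [U.map_id]
  exact h2

/-- **IUTchII:Cor4.10(v)** (kurims p. 160) / **IUTchIII:Thm1.5(v)** (p. 50) — THE SHAPE plan/GAP-LEDGER.md G-w4d009-1 asks
for: `D^⊩(−)` kills every automorphism of every `D^⊢`-prime-strip, `B.realified.mapIso a = Iso.refl _`.
[claim: Mochizuki2012, status: disputed] -/
theorem realified_mapIso_eq_refl_of_realifiedD {X : S.Dv} (a : X ≅ X) : B.realified.mapIso a = Iso.refl _ :=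
  Iso.ext (B.realified_map_endo_of_realifiedD line c hc Φ U η a.hom)

/-- **IUTchII:Cor4.10(v)** (kurims p. 160) … and identifies PARALLEL isomorphisms of `D^⊢`-prime-strips: the consumer-side
hypothesis `RealifiedRigidAt X Y` (FACT-LIST F-2066) PROVED at EVERY pair for such a bi-coric datum.
[claim: Mochizuki2012, status: disputed] -/
theorem realifiedRigidAt_of_realifiedD (X Y : S.Dv) : B.RealifiedRigidAt X Y :=
  B.realifiedRigidAt_of_self
    ((B.realifiedRigidAt_self_iff X).mpr fun a => B.realified_mapIso_eq_refl_of_realifiedD line c hc Φ U η a) Y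

/-- **IUTchIII:Thm1.5(v)** (kurims p. 50) "induce … AN isomorphism of collections of data
`(D^⊩(^{n,m}D^⊢_△), Prime(D^⊩(^{n,m}D^⊢_△)) ⥲ V̲, {^{n,m}ρ_{D^⊩,v}}_v) ⥲ (D^⊩(^{n′,m′}D^⊢_△), …)`" — PROVED for every bi-coric datum whose
`D^⊩(−)` is [IUTchII] Cor 4.5 (ii)'s functor (FACT-LIST F-2067 at such `B`). [claim: Mochizuki2012, status: disputed] -/
theorem thm15vSingleIso_of_realifiedD : B.Thm15vSingleIso :=
  B.thm15vSingleIso_iff_mapIso_aut.mpr fun _ a => B.realified_mapIso_eq_refl_of_realifiedD line c hc Φ U η a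

/-- **IUTchIII:Thm1.5(v)** (kurims pp. 50–51) "bi-coric": THE isomorphisms `(D^⊩(^{p}D^⊢_△), …) ⥲ (D^⊩(^{q}D^⊢_△), …)` compose
transitively along the lattice. [claim: Mochizuki2012, status: disputed] -/
theorem biCoricRealifiedIso_trans_of_realifiedD {H₁ H₂ H₃ : S.DHT}
    (h₁₂ : Nonempty (B.dvDeltaOf H₁ ≅ B.dvDeltaOf H₂)) (h₂₃ : Nonempty (B.dvDeltaOf H₂ ≅ B.dvDeltaOf H₃))
    (h₁₃ : Nonempty (B.dvDeltaOf H₁ ≅ B.dvDeltaOf H₃)) :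
    B.biCoricRealifiedIso h₁₂ ≪≫ B.biCoricRealifiedIso h₂₃ = B.biCoricRealifiedIso h₁₃ :=
  B.biCoricRealifiedIso_trans (B.thm15vSingleIso_of_realifiedD line c hc Φ U η) h₁₂ h₂₃ h₁₃

/-- **IUTchIII:Thm1.5(v)** (kurims pp. 50–51) … invert … [claim: Mochizuki2012, status: disputed] -/
theorem biCoricRealifiedIso_symm_of_realifiedD {H₁ H₂ : S.DHT}
    (h₁₂ : Nonempty (B.dvDeltaOf H₁ ≅ B.dvDeltaOf H₂)) (h₂₁ : Nonempty (B.dvDeltaOf H₂ ≅ B.dvDeltaOf H₁)) :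
    (B.biCoricRealifiedIso h₁₂).symm = B.biCoricRealifiedIso h₂₁ :=
  B.biCoricRealifiedIso_symm (B.thm15vSingleIso_of_realifiedD line c hc Φ U η) h₁₂ h₂₁

/-- **IUTchIII:Thm1.5(v)** (kurims p. 50) … and are the identity at one Hodge theater. [claim: Mochizuki2012, status: disputed] -/
theorem biCoricRealifiedIso_self_of_realifiedD (H : S.DHT) (hH : Nonempty (B.dvDeltaOf H ≅ B.dvDeltaOf H)) :
    B.biCoricRealifiedIso hH = Iso.refl _ :=
  B.biCoricRealifiedIso_self (B.thm15vSingleIso_of_realifiedD line c hc Φ U η) H hH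

/-- **IUTchIII:Thm1.5(v)** (kurims p. 51) / **IUTchII:Cor4.10(v)** (p. 161 l. 3–9) "compatible … with the `ℝ_{>0}`-orbits of
the isomorphisms `(^{n,m}C^⊩_△, …) ⥲ (D^⊩(^{n,m}D^⊢_△), …)` of [IUTchII], Corollary 4.6, (ii)": for such a bi-coric datum, at every
pair of Hodge theaters the bi-coric realified poly-isomorphism IS the single `D^⊩(d)` and the transported class between the
Frobenius-like data is its double `ℝ_{>0}`-orbit class (abc-iut-w4-d006's `realifiedTransport_eq_orbit_of_mapIso_aut`, with its
hypothesis discharged). [claim: Mochizuki2012, status: disputed] -/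
theorem realifiedTransport_eq_orbit_of_realifiedD (X Y : S.HT)
    (d : B.dvDeltaOf (S.htToD.obj X) ≅ B.dvDeltaOf (S.htToD.obj Y)) :
    B.biCoricRealifiedPolyIso (S.htToD.obj X) (S.htToD.obj Y) = PolyIso.single (B.realified.mapIso d) ∧
    B.realifiedTransport X Y =
      ((B.realifiedKummer X).comp (PolyIso.single (B.realified.mapIso d))).comp (B.realifiedKummer Y).symm :=
  B.realifiedTransport_eq_orbit_of_mapIso_aut
    (fun _ α => B.realified_mapIso_eq_refl_of_realifiedD line c hc Φ U η α) X Y d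

end RealifiedD

end BiCoricData

/-! ### §B at the glue: the GAP row's literal signature and abc-iut-w4-d006's lattice theorems, `hv` discharged -/

namespace LatticeGlue

variable {S : StripFrame.{u}} (G : LatticeGlue S) (Λ : LogThetaLatticeDiagram G.logData G.linkData)
  {V : Type u₂} {𝒟 : Type u₁} [Category.{v₁} 𝒟] (line : 𝒟 → V → RLine.{w}) (c : V → ℝ) (hc : ∀ v, 0 < c v)
  (Φ : S.Dv ⥤ 𝒟) (U : G.biCoric.RFrob ⥤ RlfData.{u₂, w} V) [U.Faithful]
  (η : G.biCoric.realified ⋙ U ≅ Φ ⋙ realifiedD line c hc)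

include η

/-- **IUTchII:Cor4.10(v)** (kurims p. 160) / **IUTchIII:Thm1.5(v)** (pp. 50–51) — plan/GAP-LEDGER.md **G-w4d009-1**, literal
signature `cor410v_realified_kills_aut (G : LatticeGlue S) (H : S.DHT) (a : G.biCoric.dvDeltaOf H ≅ G.biCoric.dvDeltaOf H) :
G.biCoric.realified.mapIso a = Iso.refl _`, PROVED for every glued log-theta-lattice datum whose `D^⊩(−)` is [IUTchII]
Cor 4.5 (ii)'s functor `realifiedD` (read faithfully in `RlfData V`, up to `η`). [claim: Mochizuki2012, status: disputed] -/
theorem cor410v_realified_kills_aut_of_realifiedD (H : S.DHT)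
    (a : G.biCoric.dvDeltaOf H ≅ G.biCoric.dvDeltaOf H) : G.biCoric.realified.mapIso a = Iso.refl _ :=
  G.biCoric.realified_mapIso_eq_refl_of_realifiedD line c hc Φ U η a

/-- **IUTchIII:Thm1.5(v)** (kurims p. 50) abc-iut-w4-d006's `thm15v_singleIso_lattice` with its rigidity hypothesis `hv`
DISCHARGED: along the WHOLE lattice the bi-coric realified poly-isomorphism between `^{p}D^⊢_△` and `^{q}D^⊢_△` is the SINGLE
isomorphism `D^⊩(d)`. [claim: Mochizuki2012, status: disputed] -/
theorem thm15v_singleIso_lattice_of_realifiedD (p q : ℤ × ℤ) :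
    G.biCoric.biCoricRealifiedPolyIso (S.htToD.obj (Λ.HT p)) (S.htToD.obj (Λ.HT q)) =
      PolyIso.single (G.biCoric.realified.mapIso (G.biCoric.dvDelta.mapIso
        (S.iso_nonempty_DHT (S.htToD.obj (Λ.HT p)) (S.htToD.obj (Λ.HT q))).some)) :=
  G.thm15v_singleIso_lattice Λ
    (fun _ _ => G.biCoric.realifiedRigidAt_of_realifiedD line c hc Φ U η _ _) p q

/-- **IUTchIII:Thm1.5(v)** (kurims p. 51) abc-iut-w4-d006's `thm15v_orbit_compat_horizontal` with `hv` DISCHARGED: for every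
constituent `Ψ` of the horizontal arrow's poly-isomorphism the transported class between `(^{n,m}C^⊩_△, …)` and
`(^{n+1,m}C^⊩_△, …)` is the double `ℝ_{>0}`-orbit class of the single `D^⊩(d_Ψ)`. [claim: Mochizuki2012, status: disputed] -/
theorem thm15v_orbit_compat_horizontal_of_realifiedD (n m : ℤ)
    {Ψ : G.linkData.fxmDelta.obj (Λ.HT (n, m)) ≅ G.linkData.fxmDelta.obj (Λ.HT (n + 1, m))}
    (hΨ : Ψ ∈ G.linkData.linkInducedFxm Λ.kind (Λ.HT (n, m)) (Λ.HT (n + 1, m))) :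
    G.biCoric.realifiedTransport (Λ.HT (n, m)) (Λ.HT (n + 1, m)) =
      ((G.biCoric.realifiedKummer (Λ.HT (n, m))).comp
          (PolyIso.single (G.biCoric.realified.mapIso (G.biCoric.dvConj (G.biCoric.kummerTransport
            (G.fxmDeltaHT_iso.app (Λ.HT (n, m)) ≪≫ Ψ ≪≫ (G.fxmDeltaHT_iso.app (Λ.HT (n + 1, m))).symm)))))).comp
        (G.biCoric.realifiedKummer (Λ.HT (n + 1, m))).symm :=
  G.thm15v_orbit_compat_horizontal Λ
    (fun _ _ => G.biCoric.realifiedRigidAt_of_realifiedD line c hc Φ U η _ _) n m hΨ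

end LatticeGlue

end Literature.IUT.LogThetaLattice
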